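/-
Origin: expansion seat `planner-pub-hodgecm-mc-theta-3-g9-0`, handover #S5 17:39Z md5 4c1f99a6eab5 (265 l.; WHOLE-FILE REPLACEMENT of RUN-36 #R2 99e9f7971f15 (else of PKG 95f6f115805d, 261 l.); theta-3-g8 bytes.) (`HOME/mc/pub-hodgecm-mc-theta-3-g9/lean/stage/HodgeCM/Model/ArchKTypePin.lean`, md5 4c1f99a6, 265 lines);
landed by the gen-13 packager (p-g13) in gate run 37 REPLACES the earlier landed copy of `HodgeCM/Model/ArchKTypePin.lean` (verbatim).
-/
/-
(Θ-sat)/(W1) #R2′ DRAFT by `planner-pub-hodgecm-mc-theta-3-g8-0` 2026-08-19 over the (C-Kf∞) re-cut #R2 99e9f7971f15: `ofArchRead`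
takes `(sat)` after `(level)`; the two `@[simp]` projections follow; everything else byte-identical.  UNCHECKED (RUN 37).
Origin: expansion seat `planner-pub-hodgecm-mc-theta-3-g4-0`, handover #3 05:34Z md5 960431084322 (257 l.; NEW additive PKG Model leaf, ns HodgeCM.Model (+ .ArchKTypeData); imports INSTALLED `HodgeCM.Model.ArchKType` ONLY — NO prerequisite row, NOT a dependent of `Model/ThetaSpaceInputPin` (unaffected by the v2 joint cut; loose rc 0 against both the RUN-33 PKG mirror `olean/` and the v2 mirror `olean2/`); node W6a/W6b E-binder `C : ArchKTypeData`, fields (W-ω) `ωinf` (`HOME/mc/pub-hodgecm-mc-theta-3-g4/lean/stage/HodgeCM/Model/ArchKTypePin.lean`, md5 96043108, 257 lines);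
landed by the gen-10 packager (p-g10) in gate run 34 as `HodgeCM/Model/ArchKTypePin.lean` (verbatim).
-/
/-
Copyright (c) 2026. Released under Apache 2.0 license as described in the file LICENSE.
Cell pub-hodgecm, MODEL layer (construction prover mc-theta-3, gen 4), node W6a / W6b (E-binder `C : ArchKTypeData`,
fields (W-ω) `ωinf` and (W-⊗′) `prodN`) of `MODEL-DAG.md`: the archimedean action is READ OFF the pair action.
-/
import Summits.HodgeConjecture.HodgeCM.Model.ArchKType

/-!
# The archimedean action `ωinf` of `ArchKTypeData` is read off the pair action (rigidity + smart constructor)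

`Model/ArchKType` asks the supplier of `C : ArchKTypeData X k N` for an archimedean action
`ωinf : Representation ℂ X.G₁ 𝒮((J → K_∞), ℂ)` (DATA) together with the product identity (W-⊗′)
`prodN : ω (ιinf Γ₀ g, 1) (φ_N(Φ_∞)) = φ_N(ωinf g Φ_∞)`.  This file shows that the pair `(ωinf, prodN)` carries NO
data beyond one `Prop` about the theta-space input `X`:

* § 1 `testFun_apply_piAdeleSplit`, `testFun_injective`, `testFunₗ_injective` — the archimedean slot
  `Φ_∞ ↦ φ_N(Φ_∞) = Φ_∞ ⊗ 1_{x₀ + N𝒪̂^J}` is INJECTIVE (evaluate at the adele `(a, ι_f x₀)`: the base point lies in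
  its own thin coset, so `φ_N(Φ_∞)(a, ι_f x₀) = Φ_∞(a)`);
* § 2 (generic; `ρ : Representation ℂ G 𝒮(𝔸_K^J)`, base point `x₀`, level `N`) `IsArchOnTestFun ρ x₀ N` — every
  `ρ g` maps each level-`N` thin-coset test function at `x₀` to another one:
  `∀ g Φ_∞, ∃ Ψ_∞, ρ g (φ_N(Φ_∞)) = φ_N(Ψ_∞)`; under it the READ-OFF `archReadRep h : Representation ℂ G 𝒮((J → K_∞), ℂ)`
  (`Ψ_∞` is unique by § 1, hence linear and multiplicative in `g`) with `archReadRep_testFun :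
  ρ g (φ_N(Φ_∞)) = φ_N(archReadRep h g Φ_∞)` and `archReadRep_unique` (any map with this identity IS the read-off);
* § 3 (the model) `ArchKTypeData.archRestr X k Γ₀ := ω_{P k} ∘ (ιinf Γ₀ ·, 1)`, the archimedean-factor restriction
  of the pair action; `ArchKTypeData.isArchOnTestFun C` — the fields `(ωinf, prodN)` of ANY `C` witness
  `IsArchOnTestFun (archRestr X k C.Γ₀) x₀ N`; RIGIDITY `ArchKTypeData.ωinf_eq_archReadRep` — `C.ωinf` IS the
  read-off, so `ArchKTypeData.ωinf_eq_of_ιinf_eq`: two data at the same `(X, k, N)` with the same archimedean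
  inclusion `ιinf Γ₀` have the SAME `ωinf`; and the SMART CONSTRUCTOR `ArchKTypeData.ofArchRead` — an
  `ArchKTypeData` from the `Prop` `IsArchOnTestFun (archRestr X k Γ₀) x₀ N` and the remaining fields, with
  `ωinf := archReadRep h` a TERM and `prodN` PROVED, (W-K∞′) `harm` stated over the read-off.

Relation to the tree.  `Literature/NumberTheory/Weil1964/AdelicMetaplecticArchRep` (theta-2 lineage, p182910)
constructs `archRep ρ` / `archRepMp s` under the STRONGER hypothesis that every `ρ g` is an archimedean operator
`A ⊗ 1` on all of `𝒮(𝔸_K^J)` (`archPart`, Weil 1964 Chap. III n° 37–38), and proves the thin-coset identity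
`omega_thinCosetTestFunₗ`; that identity is exactly a witness of `IsArchOnTestFun`, and by `archReadRep_unique` the
two read-offs then agree.  The present file needs only the level-`N` thin-coset identity (the shape of `prodN`),
whose import cone is already in the package.  Nothing is cited and nothing is minted: definitions and kernel
lemmas over `Model/ArchKType`.
-/

set_option autoImplicit false

noncomputable section

open MeasureTheory
open Literature.NumberTheory.Automorphic Literature.NumberTheory.Weil1964
open Literature.AlgebraicGeometry.HodgeTheory
open Literature.NumberTheory.Automorphic.PicardCM
open HodgeCM.PerL34.Seesaw HodgeCM.PerL34.RationalCoset HodgeCM.PerL34.SupplyAdelic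
open HodgeCM.Model.SupplyInstance HodgeCM.Model.SupplyResidual
open HodgeCM.Model.ThetaSpace
open NumberField.mixedEmbedding IsDedekindDomain
open scoped Classical SchwartzMap NumberField

namespace HodgeCM
namespace Model

/-! ### § 1. The archimedean slot `Φ_∞ ↦ φ_N(Φ_∞)` is injective -/

section TestFunInjective

variable {K : Type} [Field K] [NumberField K] {J : Type} [Fintype J]

attribute [local instance] SupplyInstance.ratModule

/-- `φ_N(Φ_∞)` at the adele with archimedean component `a` and finite component the base point `ι_f x₀` is
`Φ_∞(a)` (the base point lies in its own thin coset). -/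
theorem testFun_apply_piAdeleSplit (Φinf : 𝓢((J → mixedSpace K), ℂ)) (x₀ : J → K) (N : ℕ)
    (a : J → mixedSpace K) :
    (testFun K J Φinf x₀ N : (J → NumberField.AdeleRing (𝓞 K) K) → ℂ) (piAdeleSplit K J (a, finEmb K J x₀)) = Φinf a := by
  rw [coe_testFun, thinCosetTestFun_of_mem Φinf _ _ (v := piAdeleSplit K J (a, finEmb K J x₀)) _,
    piArch_piAdeleSplit]
  rw [piFinite_piAdeleSplit, neg_add_cancel]
  exact (piLevelIdeal K J _).zero_mem

/-- **`Φ_∞ ↦ φ_N(Φ_∞)` is injective.** -/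
theorem testFun_injective (x₀ : J → K) (N : ℕ) :
    Function.Injective fun Φinf : 𝓢((J → mixedSpace K), ℂ) => testFun K J Φinf x₀ N := by
  intro Φ Ψ h
  ext a
  have h' := congrArg (fun F : piSchwartzBruhat K J => (F : (J → NumberField.AdeleRing (𝓞 K) K) → ℂ)
    (piAdeleSplit K J (a, finEmb K J x₀))) h
  simpa only [testFun_apply_piAdeleSplit] using h'

/-- `testFunₗ K J x₀ N` is injective. -/
theorem testFunₗ_injective (x₀ : J → K) (N : ℕ) : Function.Injective (testFunₗ K J x₀ N) :=
  testFun_injective x₀ N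

end TestFunInjective

/-! ### § 2. The read-off of a representation acting archimedean on the level-`N` test functions -/

section ArchRead

variable {K : Type} [Field K] [NumberField K] {J : Type} [Fintype J] {G : Type*} [Monoid G]

/-- **`ρ` acts ARCHIMEDEAN on the level-`N` thin-coset test functions at `x₀`**: every `ρ g` maps each
`φ_N(Φ_∞) = Φ_∞ ⊗ 1_{x₀ + N𝒪̂^J}` to some `φ_N(Ψ_∞)` (the shape of `ArchKTypeData.prodN`). -/
def IsArchOnTestFun (ρ : Representation ℂ G (piSchwartzBruhat K J)) (x₀ : J → K) (N : ℕ) : Prop :=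
  ∀ (g : G) (Φinf : 𝓢((J → mixedSpace K), ℂ)), ∃ Ψinf : 𝓢((J → mixedSpace K), ℂ),
    ρ g (testFun K J Φinf x₀ N) = testFun K J Ψinf x₀ N

variable {ρ : Representation ℂ G (piSchwartzBruhat K J)} {x₀ : J → K} {N : ℕ} (h : IsArchOnTestFun ρ x₀ N)

/-- The read-off as a bare function: the (unique) `Ψ_∞` with `ρ g (φ_N(Φ_∞)) = φ_N(Ψ_∞)`. -/
def archRead (g : G) (Φinf : 𝓢((J → mixedSpace K), ℂ)) : 𝓢((J → mixedSpace K), ℂ) := (h g Φinf).choose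

/-- (Ported verbatim from the HodgeCMPerL package; no docstring in the source.) -/
theorem testFun_archRead (g : G) (Φinf : 𝓢((J → mixedSpace K), ℂ)) :
    ρ g (testFun K J Φinf x₀ N) = testFun K J (archRead h g Φinf) x₀ N :=
  (h g Φinf).choose_spec

/-- The same through the linear slot `testFunₗ`. -/
theorem testFunₗ_archRead (g : G) (Φinf : 𝓢((J → mixedSpace K), ℂ)) :
    ρ g (testFunₗ K J x₀ N Φinf) = testFunₗ K J x₀ N (archRead h g Φinf) :=
  testFun_archRead h g Φinf

/-- Uniqueness of the read-off (injectivity of the archimedean slot). -/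
theorem archRead_eq_of_testFun_eq {g : G} {Φinf Ψinf : 𝓢((J → mixedSpace K), ℂ)}
    (hΨ : ρ g (testFun K J Φinf x₀ N) = testFun K J Ψinf x₀ N) : archRead h g Φinf = Ψinf :=
  testFun_injective x₀ N ((testFun_archRead h g Φinf).symm.trans hΨ)

/-- Uniqueness, `testFunₗ` form. -/
theorem archRead_eq_of_testFunₗ_eq {g : G} {Φinf Ψinf : 𝓢((J → mixedSpace K), ℂ)}
    (hΨ : ρ g (testFunₗ K J x₀ N Φinf) = testFunₗ K J x₀ N Ψinf) : archRead h g Φinf = Ψinf :=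
  archRead_eq_of_testFun_eq h hΨ

/-- The read-off at `g` is `ℂ`-linear. -/
def archReadₗ (g : G) : 𝓢((J → mixedSpace K), ℂ) →ₗ[ℂ] 𝓢((J → mixedSpace K), ℂ) where
  toFun := archRead h g
  map_add' Φ Ψ := archRead_eq_of_testFunₗ_eq h <| by
    rw [map_add, map_add, map_add, testFunₗ_archRead h g Φ, testFunₗ_archRead h g Ψ]
  map_smul' a Φ := by
    rw [RingHom.id_apply]
    exact archRead_eq_of_testFunₗ_eq h <| by
      rw [map_smul, map_smul, map_smul, testFunₗ_archRead h g Φ]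

/-- (Ported verbatim from the HodgeCMPerL package; no docstring in the source.) -/
@[simp] theorem archReadₗ_apply (g : G) (Φinf : 𝓢((J → mixedSpace K), ℂ)) :
    archReadₗ h g Φinf = archRead h g Φinf := rfl

/-- **The read-off representation** `g ↦ (Φ_∞ ↦ Ψ_∞)` of `G` on `𝒮((J → K_∞), ℂ)`. -/
def archReadRep : Representation ℂ G 𝓢((J → mixedSpace K), ℂ) where
  toFun := archReadₗ h
  map_one' := LinearMap.ext fun Φ => archRead_eq_of_testFun_eq h <| by
    rw [map_one]; rfl
  map_mul' g g' := LinearMap.ext fun Φ => archRead_eq_of_testFun_eq h <| by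
    rw [map_mul, Module.End.mul_apply, testFun_archRead h g' Φ, testFun_archRead h g]
    rfl

/-- (Ported verbatim from the HodgeCMPerL package; no docstring in the source.) -/
theorem archReadRep_apply (g : G) (Φinf : 𝓢((J → mixedSpace K), ℂ)) :
    archReadRep h g Φinf = archRead h g Φinf := rfl

/-- **The test-function identity of the read-off**: `ρ g (φ_N(Φ_∞)) = φ_N(archReadRep h g Φ_∞)`. -/
theorem archReadRep_testFun (g : G) (Φinf : 𝓢((J → mixedSpace K), ℂ)) :
    ρ g (testFun K J Φinf x₀ N) = testFun K J (archReadRep h g Φinf) x₀ N :=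
  testFun_archRead h g Φinf

/-- **Uniqueness**: any map `A` (not assumed linear) with the test-function identity at `g` IS the read-off. -/
theorem archReadRep_unique {g : G} {A : 𝓢((J → mixedSpace K), ℂ) → 𝓢((J → mixedSpace K), ℂ)}
    (hA : ∀ Φinf, ρ g (testFun K J Φinf x₀ N) = testFun K J (A Φinf) x₀ N)
    (Φinf : 𝓢((J → mixedSpace K), ℂ)) : A Φinf = archReadRep h g Φinf :=
  (archRead_eq_of_testFun_eq h (hA Φinf)).symm

end ArchRead

/-! ### § 3. The model: `ArchKTypeData.ωinf` is the read-off of `ω_{P k} ∘ (ιinf Γ₀ ·, 1)` -/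

section ModelPin

variable {U : Universe} {Lc : CMField} {ι₁ : Lc →+* ℂ} {V : HermSpace3 Lc ι₁} {c : SeesawCtx Lc}

namespace ArchKTypeData

/-- **The archimedean-factor restriction** `g ↦ ω_{P k} (ιinf Γ₀ g, 1)` of the pair action of type index `k`
along the archimedean inclusion at the level `Γ₀`. -/
def archRestr (X : ThetaSpaceInput U V c) (k : Fin 4) (Γ₀ : Level V) :
    Representation ℂ X.G₁ (piSchwartzBruhat X.K X.J) :=
  (X.P k).ω.comp ((MonoidHom.inl X.GU (relNormOneIdeles X.K X.L)).comp (X.ιinf Γ₀))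

/-- (Ported verbatim from the HodgeCMPerL package; no docstring in the source.) -/
theorem archRestr_apply (X : ThetaSpaceInput U V c) (k : Fin 4) (Γ₀ : Level V) (g : X.G₁) :
    archRestr X k Γ₀ g = (X.P k).ω (X.ιinf Γ₀ g, 1) := rfl

variable {X : ThetaSpaceInput U V c} {k : Fin 4} {N : ℕ} (C : ArchKTypeData X k N)

/-- The fields `(ωinf, prodN)` of an `ArchKTypeData` WITNESS that the restriction acts archimedean on the
level-`N` test functions. -/
theorem isArchOnTestFun : IsArchOnTestFun (archRestr X k C.Γ₀) (X.P k).x₀ N :=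
  fun g Φinf => ⟨C.ωinf g Φinf, C.prodN g Φinf⟩

/-- **RIGIDITY of `ωinf`**: the archimedean action of ANY `ArchKTypeData` is the read-off of the pair action. -/
theorem ωinf_eq_archReadRep (g : X.G₁) (Φinf : 𝓢((X.J → mixedSpace X.K), ℂ)) :
    C.ωinf g Φinf = archReadRep C.isArchOnTestFun g Φinf :=
  archReadRep_unique C.isArchOnTestFun (fun Φ => C.prodN g Φ) Φinf

/-- The read-off does not depend on the witness: any `h` gives `C.ωinf`. -/
theorem archReadRep_eq_ωinf (h : IsArchOnTestFun (archRestr X k C.Γ₀) (X.P k).x₀ N) (g : X.G₁)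
    (Φinf : 𝓢((X.J → mixedSpace X.K), ℂ)) : archReadRep h g Φinf = C.ωinf g Φinf :=
  (archReadRep_unique h (fun Φ => C.prodN g Φ) Φinf).symm

/-- **Two archimedean `K`-type data at the same `(X, k, N)` with the same archimedean inclusion have the same
`ωinf`.** -/
theorem ωinf_eq_of_ιinf_eq (C C' : ArchKTypeData X k N) (hι : X.ιinf C.Γ₀ = X.ιinf C'.Γ₀) :
    C.ωinf = C'.ωinf := by
  refine MonoidHom.ext fun g => LinearMap.ext fun Φinf => ?_
  have hA : ∀ Φ, archRestr X k C'.Γ₀ g (testFun X.K X.J Φ (X.P k).x₀ N) =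
      testFun X.K X.J (C.ωinf g Φ) (X.P k).x₀ N := fun Φ => by
    rw [archRestr_apply, ← hι]
    exact C.prodN g Φ
  exact (archReadRep_unique C'.isArchOnTestFun hA Φinf).trans (C'.ωinf_eq_archReadRep g Φinf).symm

/-- **SMART CONSTRUCTOR**: archimedean `K`-type data from the `Prop` «the restriction along `ιinf Γ₀` acts
archimedean on the level-`N` test functions» and the remaining fields; `ωinf` is the read-off (a TERM) and (W-⊗′)
`prodN` is PROVED; (W-K∞′) `harm` is asked of the read-off. -/
def ofArchRead (Γ₀ : Level V) (h : IsArchOnTestFun (archRestr X k Γ₀) (X.P k).x₀ N)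
    (K₂ : Type) [Group K₂] (κ₂ : K₂ →* X.GU) (comm : ∀ (m : K₂) (x : X.G₁), Commute (κ₂ m) (X.ιinf Γ₀ x))
    (level : ∀ δ ∈ X.Δ Γ₀, ∃ m : K₂, X.ιinf Γ₀ δ * κ₂ m ∈ (X.P k).ΓU)
    (sat : ∀ g ∈ X.KΓ Γ₀, ∃ m : K₂, κ₂ m = g)
    (Φarch : Module.Dual ℂ X.W →ₗ[ℂ] 𝓢((X.J → mixedSpace X.K), ℂ)) (ℓ₀ : Module.Dual ℂ X.W)
    (arch₀ : Φarch ℓ₀ = (X.P k).Φinf)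
    (fixN : ∀ (m : K₂) (ℓ : Module.Dual ℂ X.W),
      (X.P k).ω (κ₂ m, 1) (testFun X.K X.J (Φarch ℓ) (X.P k).x₀ N) = testFun X.K X.J (Φarch ℓ) (X.P k).x₀ N)
    (harm : ∀ (u : X.K₁) (ℓ : Module.Dual ℂ X.W), archReadRep h (X.κ₁ u) (Φarch ℓ) = Φarch (X.τ₁.dual u ℓ)) :
    ArchKTypeData X k N where
  Γ₀ := Γ₀
  K₂ := K₂
  κ₂ := κ₂
  comm := comm
  level := level
  sat := sat
  Φarch := Φarch
  ℓ₀ := ℓ₀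
  arch₀ := arch₀
  ωinf := archReadRep h
  fixN := fixN
  prodN g Φinf := archReadRep_testFun h g Φinf
  harm := harm

/-- (Ported verbatim from the HodgeCMPerL package; no docstring in the source.) -/
@[simp] theorem ofArchRead_Γ₀ (Γ₀ : Level V) (h : IsArchOnTestFun (archRestr X k Γ₀) (X.P k).x₀ N)
    (K₂ : Type) [Group K₂] (κ₂ : K₂ →* X.GU) (comm) (level) (sat) (Φarch) (ℓ₀ : Module.Dual ℂ X.W) (arch₀) (fixN)
    (harm) : (ofArchRead (X := X) (k := k) (N := N) Γ₀ h K₂ κ₂ comm level sat Φarch ℓ₀ arch₀ fixN harm).Γ₀ = Γ₀ :=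
  rfl

/-- (Ported verbatim from the HodgeCMPerL package; no docstring in the source.) -/
@[simp] theorem ofArchRead_ωinf (Γ₀ : Level V) (h : IsArchOnTestFun (archRestr X k Γ₀) (X.P k).x₀ N)
    (K₂ : Type) [Group K₂] (κ₂ : K₂ →* X.GU) (comm) (level) (sat) (Φarch) (ℓ₀ : Module.Dual ℂ X.W) (arch₀) (fixN)
    (harm) :
    (ofArchRead (X := X) (k := k) (N := N) Γ₀ h K₂ κ₂ comm level sat Φarch ℓ₀ arch₀ fixN harm).ωinf = archReadRep h :=
  rfl

/-- (Ported verbatim from the HodgeCMPerL package; no docstring in the source.) -/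
@[simp] theorem ofArchRead_Φarch (Γ₀ : Level V) (h : IsArchOnTestFun (archRestr X k Γ₀) (X.P k).x₀ N)
    (K₂ : Type) [Group K₂] (κ₂ : K₂ →* X.GU) (comm) (level) (sat) (Φarch) (ℓ₀ : Module.Dual ℂ X.W) (arch₀) (fixN)
    (harm) :
    (ofArchRead (X := X) (k := k) (N := N) Γ₀ h K₂ κ₂ comm level sat Φarch ℓ₀ arch₀ fixN harm).Φarch = Φarch :=
  rfl

end ArchKTypeData

end ModelPin

end Model
end HodgeCM
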